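/-
Copyright: cell pub-balaban-gaps (YM BLITZ Y1, track G1), seat g1-p2 GEN 6 (unit `pub-balaban-gaps-g1-p2`).  Row (D4) NODE O,
OBJECT ∕ MECHANISM level: THE TAIL-TOLERANT END WITH PRINT'S DECORATION OF THE TAIL — Theorem 3.10 at one scale for
`Δ′(u) = 1 + K′₀(u) + K′₁(u)`, `K′₀` of finite range (expanded, file 50a), `K′₁` an exponential tail split into block pairs and
s-DECORATED along a tube (file 51), resummed (file 49); `s ≡ 1` kernel `= Δ′(u)⁻¹` with every invertibility letter discharged (file 50).
HONEST FRAMING: packaging at MODEL generality over hypothesis SHAPES; nothing of Bałaban's constructed or asserted; (D4) NOT discharged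
(instance 0∕1); NOT BetaPertH, NOT continuum, NOT Clay.
-/
import Summits.QuantumFields.BalabanUV.Gaps.D4WalkBlockAccretiveTail
import Summits.QuantumFields.BalabanUV.Gaps.D4WalkBlockTailDecorated

/-!
# `Gaps.D4WalkBlockAccretiveTailDecorated` — Thm 3.10 at one scale for `Δ′ = 1 + K′_{≤r₁} + K′_tail` with the tail s-DECORATED
# ([II] p. 3 ∕ (1.11)): the (U)-road END, planner residue R49-1 closed in kernel (cell pub-balaban-gaps, seat g1-p2 GEN 6)

HONEST DEPENDENCY (cell pub-balaban, verbatim): continuum YM on T⁴ ⇐ BetaPertH ∧ nine spine estimates (0/9 proved);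
BetaPertH ⇐ (D1) ∧ (D4) ∧ CAP+tail.

WHY.  File 50's END resums a σ-INDEPENDENT tail (print's (3.130) use: a plaquette-local `Δ′_π`); in print every term of a
propagator's expansion is s-decorated ([II] p. 3, (1.11) p. 5), so a tail crossing the decoupling surfaces undecorated interpolates
differently (planner g1-plan-1 GEN 17, residue R49-1).  THIS FILE is the same END with the tail DECORATED: 50a's pinned-rate expansion
`W(s,u)` of the constructed local inverses of `1 + K′₀` (47's letters), 51's decorated tail `V(s,u)` (`V(1,u) = K′₁(u)`; decoration ∕
tube letters per block pair), 49's general resolvent step `blockWalkExpansion_tail_bwe` with the nesting `ρ_W + μ ≤ ρ_V − κ₁P₁ᵗ`,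
`ρ_V − ε_V = ρ₀ − ε₀`, `κ_W + μ ≤ κ_V := κ₀ − μ` DISPLAYED, and 50's discharge of the `s ≡ 1` letters:
* `blockWalkExpansion_accretive_tail_decorated` — `W(s,u)(1 + V(s,u)W(s,u))⁻¹` is a `BlockWalkExpansion` at
  `(ε₀ − 3μ − κ₁P∕r₀ − 2μ, κ₀ − 4μ)`, walk rate `ρ₀ − 3μ − κ₁P∕r₀ − 2μ`, constant `c_μK_W(1−q_t)⁻¹c_μ` with
  `q_t = c_μ(c_μ·1·(1·(c_μK̄_VK_Wc_μ))c_μ)c_μ`, `K̄_V = e^{κ₁P₀ᵗ}·(e^{(ρ_V−ρ₀+ε₀)s}·λ₁c_μ²)`, for any `K_W` above 47's constant (displayed);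
* `blockWalkExpansion_accretive_tail_endpoint` — the same with 51's ENDPOINT decoration: NO hypothesis beyond file 50's own (the
  decoration uses the one-scale END's packing letter `hpack`; no tube count, no rate shift; `K̄_V = e^{κ₁P}·(e^{(ρ_V−ρ₀+ε₀)2R_b}·λ₁c_μ²`) —
  BOUNDS-ONLY: it meets the tree's shape but NOT print's exact decoupling at `s = 0` ([II] p. 4), which the tube variant with connected
  tubes keeps (see its docstring);
* `accretive_tail_decorated_one_eq_inv` — at `s ≡ 1` the kernel is `(1 + K′₀(u) + K′₁(u))⁻¹` (50's `accretive_tail_one_eq_inv` after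
  `V(1,u) = K′₁(u)`; applies to both ENDs).
Value: kernel-checked bookkeeping; nothing of Bałaban's asserted; words of row (D4) UNCHANGED.

References: T. Bałaban, Comm. Math. Phys. 99 (1985) 389–434 [B9], Thm 3.2 (3.48) p.398, Thm 3.7 (3.87)–(3.90) p.409, Cor 3.8
p.410, (3.95)–(3.96) p.411, Thm 3.10 (3.107)–(3.108) p.416, (3.130) p.421–422; Comm. Math. Phys. 116 (1988) 1–22 [II], p.3,
(1.11) p.5, p.13, p.15.
-/

noncomputable section

namespace Summit.QuantumFields.BalabanUV.Gaps.D4WalkBlockAccretiveTailDecorated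

open Metric Set Finset
open Literature.MathematicalPhysics.QuantumFieldTheory.Balaban1983to89
open Literature.MathematicalPhysics.QuantumFieldTheory.Balaban1983to89.B9SectDWalk (DomBy)
open Literature.MathematicalPhysics.QuantumFieldTheory.Balaban1983to89.B9Thm34Ext (toB6)
open Literature.MathematicalPhysics.QuantumFieldTheory.Balaban1983to89.B9Thm37GlueTorus (torusGeom tdist1 tdist1_nonneg)
open Literature.MathematicalPhysics.QuantumFieldTheory.Balaban1983to89.TreeLengthTorus (TPt)
open Literature.MathematicalPhysics.QuantumFieldTheory.Balaban1983to89.B5TorusCover (UT)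
open Literature.MathematicalPhysics.QuantumFieldTheory.Balaban1983to89.B11SectG (RowSum)
open Literature.MathematicalPhysics.QuantumFieldTheory.Balaban1983to89.B5Prop11Lower (nsq)
open Literature.MathematicalPhysics.QuantumFieldTheory.Balaban1983to89.B13DomainKernelWalks (DomainTerms)
open Summit.QuantumFields.BalabanUV.Gaps.D4WalkBlock (blockNorm BlockWalkExpansion)
open Summit.QuantumFields.BalabanUV.Gaps.D4WalkBlockDecorate (decTerm decKernel)
open Summit.QuantumFields.BalabanUV.Gaps.D4WalkBlockTail (blockNorm_kernel_le blockWalkExpansion_tail_bwe)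
open Summit.QuantumFields.BalabanUV.Gaps.D4WalkBlockAccretiveRate (accretive_print_rate)
open Summit.QuantumFields.BalabanUV.Gaps.D4WalkBlockAccretiveTail (blockWalkExpansion_mono_const accretive_tail_one_eq_inv)
open Summit.QuantumFields.BalabanUV.Gaps.D4WalkBlockTailDecorated
  (blockCut endpointDec blockWalkExpansion_tail_decorated blockWalkExpansion_tail_decorated_endpoint)
open Summit.QuantumFields.BalabanUV.T4Continuum.Spine.NE5.TwoRunPencilDomains (withOp)
open Summit.QuantumFields.BalabanUV.Beta.UnitLatticeWalkInversion (Hd)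
open Summit.QuantumFields.BalabanUV.Beta.UnitLatticeLocalInverse (compress extend)
open Summit.QuantumFields.BalabanUV.Beta.AccretiveCombesThomas (conjForm)

variable {ν : ℕ} {K : Fin ν → ℕ} [∀ i, NeZero (K i)]
variable {n : Type} [Fintype n] [DecidableEq n]
variable {d N' : ℕ}
variable {E : Type*} [NormedAddCommGroup E] [NormedSpace ℂ E]
variable {L₀ : DomainTerms d N' ν K n n E} {h : L₀.B → n → ℝ} {Es : L₀.B → Finset n} {K0 K1 : E → Matrix n n ℂ}
variable {ds : n → n → ℝ}
variable {c₀ c : B13.Consts} {cubn : n → UT K} {X : Finset (UT K)} {R CK M m κc κ' cs' r₁ r lam1 ρV KW s : ℝ} {nD nC nB : ℕ}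
variable {ρ₀ ε₀ κ₀ μ cμ : ℝ}

/-- **THEOREM 3.10 AT ONE SCALE FOR `Δ′(u) = 1 + K′₀(u) + K′₁(u)`, THE TAIL s-DECORATED.**  47's letters for `K′₀` (as in 50's END:
`4μ ≤ κ₀`, shift `κ₁P∕r₀ ≤ ε₀ − 5μ`), the tail `K′₁` holomorphic with ONE decaying block letter `(λ₁, ρ_V)`,
`ρ_V ≥ ρ₀ − 2μ − κ₁P∕r₀ + κ₁P₁ᵗ`, decoration data per block pair (`decV`, NEAR letter with slack `s`, TUBE letter `(P₀ᵗ, P₁ᵗ)`), any `K_W`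
above the one-scale constant, and the tail margin `q_t < 1` ⟹ the resummed decorated family is a `BlockWalkExpansion` (module
docstring), with `W(1,u) = S(u)(1 − R(u))⁻¹`, `V(1,u) = K′₁(u)`, `‖W(1,u)‖_{y,y′} ≤ K_We^{−(κ₀−2μ)d₁}`, dominating distances.
Composition BY NAME: 50a → 51 → 49. [cite: Balaban1985BackgroundPropagators, Thm 3.2 (3.48) p.398, Thm 3.7 (3.87)–(3.90) p.409, Cor 3.8 p.410, (3.95)–(3.96) p.411, Thm 3.10 (3.107)–(3.108) p.416, (3.130) p.421, p.422; Balaban1988RG2Cluster, p.3, (1.11) p.5, p.13, p.15] -/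
theorem blockWalkExpansion_accretive_tail_decorated
    (hanchor : ∀ b, L₀.anchor b ∈ L₀.dom b) (hdiam : ∀ b, ∀ z ∈ L₀.dom b, ∀ z' ∈ L₀.dom b, tdist1 K z z' ≤ r)
    (hJ0 : ∀ b, L₀.J b = ∅) (hmult : ∀ z : UT K, (Finset.univ.filter fun b => L₀.anchor b = z).card ≤ nD)
    (hsupp : ∀ b y, y ∉ Es b → h b y = 0) (habs : ∀ b y, |h b y| ≤ 1) (hE : ∀ b y, y ∈ Es b → cubn y ∈ L₀.dom b)
    (hKan : ∀ i j, DifferentiableOn ℂ (fun u => K0 u i j) (ball (0 : E) R))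
    (hKbd : ∀ u ∈ ball (0 : E) R, ∀ y y', blockNorm cubn cubn (K0 u) y y' ≤ CK) (hCK : 0 ≤ CK)
    (hM : 0 < M) (hr₁ : 0 ≤ r₁) (hsymm : ∀ i j, ds i j = ds j i) (hd0 : ∀ j, ds j j = 0)
    (hLip : ∀ b i j, |h b i - h b j| ≤ ds i j / M) (hKrange : ∀ u i j, K0 u i j ≠ 0 → ds i j ≤ r₁)
    (hdomE : ∀ b i, (∃ k ∈ Es b, ds i k ≤ r₁) → cubn i ∈ L₀.dom b)
    (hcard : ∀ b, (L₀.dom b).card ≤ nC)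
    (hm : 0 < m) (hκc : 0 ≤ κc)
    (hcoer : ∀ u ∈ ball (0 : E) R, ∀ j, ∀ z : n → ℂ, m * nsq z ≤ (conjForm (1 + K0 u) κc (fun e => ds e j) z).re)
    (hκ' : 0 ≤ κ') (hcmp : ∀ i j, ρ₀ * tdist1 K (cubn i) (cubn j) ≤ κ' * ds i j)
    (hcs' : 0 ≤ cs') (hsite' : ∀ i, ∑ j, Real.exp (-((κc - κ') * ds i j)) ≤ cs')
    (hκ₁₀ : 0 ≤ c₀.κ₁) (hr : 0 ≤ r) (hμ : 0 ≤ μ) (hμε : 3 * μ ≤ ε₀) (hμκ : 4 * μ ≤ κ₀) (hwin : κ₀ + μ ≤ ρ₀ - ε₀)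
    (hcμ : 0 ≤ cμ) (hrow : RowSum (toB6 (torusGeom K 0 0 0) 0 True) μ cμ)
    (hq : cμ * (cμ * 1 * (1 * (((nC * (r₁ / M * CK * Real.exp (κ' * r₁)) * (cs' / m)) * Real.exp (c₀.κ₁ * (0 : ℕ))) *
      Real.exp (μ * r) * (nD * cμ))) * cμ) * cμ < 1)
    (cellOf : UT K → TPt d N') (J' : L₀.B → Finset (TPt d N')) (hJ' : ∀ b, J' b ⊆ (L₀.dom b).image cellOf)
    (hJ'X : ∀ b, (J' b).Nonempty → (L₀.dom b ∩ X).Nonempty) {P : ℕ} {r₀ Rb : ℝ} (hr₀ : 0 < r₀) (hRD : r₀ + r ≤ Rb)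
    (hpack : ∀ a : UT K, ∃ S : Finset (TPt d N'), S.card ≤ P ∧ ∀ z, tdist1 K a z ≤ Rb → cellOf z ∈ S)
    (hκ₁ : 0 ≤ c.κ₁) (hshift : c.κ₁ * (P / r₀) ≤ ε₀ - 5 * μ)
    -- the tail and its decoration data
    (hK1an : ∀ i j, DifferentiableOn ℂ (fun u => K1 u i j) (ball (0 : E) R))
    (hK1bd : ∀ u ∈ ball (0 : E) R, ∀ y y', blockNorm cubn cubn (K1 u) y y' ≤ lam1 * Real.exp (-(ρV * tdist1 K y y')))
    (hlam1 : 0 ≤ lam1)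
    (decV : UT K × UT K → Finset (TPt d N')) (hs : 0 ≤ s)
    (hnear : ∀ ab, (decV ab).Nonempty → ∃ z ∈ X, tdist1 K ab.1 z + tdist1 K z ab.2 ≤ tdist1 K ab.1 ab.2 + s)
    {P₀t P₁t : ℝ} (hP₁t : 0 ≤ P₁t) (htube : ∀ ab, ((decV ab).card : ℝ) ≤ P₀t + P₁t * tdist1 K ab.1 ab.2)
    (hρV : ρ₀ - 2 * μ - c.κ₁ * (P / r₀) + c.κ₁ * P₁t ≤ ρV)
    (hKW : Real.exp (c.κ₁ * P) * (Real.exp ((ε₀ - 3 * μ) * (2 * r)) *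
          (cμ * (((cs' / m) * Real.exp (c₀.κ₁ * (0 : ℕ))) * Real.exp (μ * r) * (nD * cμ)) *
            (1 * (1 - cμ * (cμ * 1 * (1 * (((nC * (r₁ / M * CK * Real.exp (κ' * r₁)) * (cs' / m)) *
              Real.exp (c₀.κ₁ * (0 : ℕ))) * Real.exp (μ * r) * (nD * cμ))) * cμ) * cμ)⁻¹) * cμ)) ≤ KW)
    (hqt : cμ * (cμ * 1 * (1 * (cμ * (Real.exp (c.κ₁ * P₀t) * (Real.exp ((ρV - (ρ₀ - ε₀)) * s) * (lam1 * cμ * cμ))) * KW *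
      cμ)) * cμ) * cμ < 1) :
    ∃ (W₀ : Type) (T₀ : W₀ → (TPt d N' → ℂ) → E → Matrix n n ℂ) (dec₀ : W₀ → Finset (TPt d N'))
      (W : Type) (T : W → (TPt d N' → ℂ) → E → Matrix n n ℂ) (SX : Set W) (A : W → ℝ) (D : W → UT K → UT K → ℝ),
      BlockWalkExpansion c cubn cubn
        (fun σ u => decKernel T₀ dec₀ σ u *
          (1 + decKernel (fun (ab : UT K × UT K) (_ : TPt d N' → ℂ) u => blockCut cubn ab.1 ab.2 (K1 u)) decV σ u *
            decKernel T₀ dec₀ σ u)⁻¹) X R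
        (ε₀ - 3 * μ - c.κ₁ * (P / r₀) - 2 * μ) (κ₀ - 2 * μ - 2 * μ)
        (cμ * KW * (1 * (1 - cμ * (cμ * 1 * (1 * (cμ *
          (Real.exp (c.κ₁ * P₀t) * (Real.exp ((ρV - (ρ₀ - ε₀)) * s) * (lam1 * cμ * cμ))) * KW * cμ)) * cμ) * cμ)⁻¹) * cμ)
        T SX A D (ρ₀ - 3 * μ - c.κ₁ * (P / r₀) - 2 * μ) ∧
      (∀ u ∈ ball (0 : E) R, decKernel T₀ dec₀ (fun _ => 1) u =
        (withOp L₀ fun b u => Hd h b * extend (compress (1 + K0 u) (Es b))⁻¹ * Hd h b).kernel (fun _ => 1) u *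
          ((1 : Matrix n n ℂ) + (-1 : ℂ) •
            (withOp L₀ fun b u =>
              (Hd h b * K0 u - K0 u * Hd h b) * extend (compress (1 + K0 u) (Es b))⁻¹ * Hd h b).kernel (fun _ => 1) u)⁻¹) ∧
      (∀ u ∈ ball (0 : E) R,
        decKernel (fun (ab : UT K × UT K) (_ : TPt d N' → ℂ) u => blockCut cubn ab.1 ab.2 (K1 u)) decV (fun _ => 1) u = K1 u) ∧
      (∀ u ∈ ball (0 : E) R, ∀ y y', blockNorm cubn cubn (decKernel T₀ dec₀ (fun _ => 1) u) y y' ≤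
        KW * Real.exp (-((κ₀ - 2 * μ) * tdist1 K y y'))) ∧
      ∀ ω, DomBy (toB6 (torusGeom K 0 0 0) 0 True) (D ω) := by
  obtain ⟨W₀, T₀, A₀, D₀, dec₀, hB, hker, hdom₀⟩ := accretive_print_rate hanchor hdiam hJ0 hmult hsupp habs hE hKan hKbd hCK hM
    hr₁ hsymm hd0 hLip hKrange hdomE hcard hm hκc hcoer hκ' hcmp hcs' hsite' hκ₁₀ hr hμ hμε (by linarith) hwin hcμ hrow hq cellOf
    J' hJ' hJ'X hr₀ hRD hpack hκ₁ (by linarith)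
  have hq1 : 0 < 1 - cμ * (cμ * 1 * (1 * (((nC * (r₁ / M * CK * Real.exp (κ' * r₁)) * (cs' / m)) *
      Real.exp (c₀.κ₁ * (0 : ℕ))) * Real.exp (μ * r) * (nD * cμ))) * cμ) * cμ := by linarith
  have hK0 : 0 ≤ Real.exp (c.κ₁ * P) * (Real.exp ((ε₀ - 3 * μ) * (2 * r)) *
      (cμ * (((cs' / m) * Real.exp (c₀.κ₁ * (0 : ℕ))) * Real.exp (μ * r) * (nD * cμ)) *
        (1 * (1 - cμ * (cμ * 1 * (1 * (((nC * (r₁ / M * CK * Real.exp (κ' * r₁)) * (cs' / m)) *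
          Real.exp (c₀.κ₁ * (0 : ℕ))) * Real.exp (μ * r) * (nD * cμ))) * cμ) * cμ)⁻¹) * cμ)) := by
    have := hm.le; positivity
  have hB' := blockWalkExpansion_mono_const hB hKW
  have hsh : 0 ≤ c.κ₁ * (P / r₀) := mul_nonneg hκ₁ (div_nonneg (Nat.cast_nonneg P) hr₀.le)
  have hsh1 : 0 ≤ c.κ₁ * P₁t := mul_nonneg hκ₁ hP₁t
  -- the decorated tail at window ρ_V − (ρ₀ − ε₀) and torus rate κ₀ − μ (tag constants c₀, physical constants c)
  obtain ⟨hV, hV1, hVdom⟩ := blockWalkExpansion_tail_decorated (c₀ := c₀) (c := c) (cubn := cubn) (X := X)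
    (ε := ρV - (ρ₀ - ε₀)) (κ := κ₀ - μ) hκ₁₀ hlam1 hμ (by linarith) (by linarith) hrow hK1an hK1bd decV hs hnear hP₁t htube hκ₁
    (by linarith)
  obtain ⟨W, T, SX, A, D, hT, hdomT⟩ := blockWalkExpansion_tail_bwe hB' hdom₀ hV hVdom hμ (by linarith) (by linarith) (by linarith)
    (by linarith) (by linarith) (by linarith) (by positivity) (hK0.trans hKW) hcμ hrow hqt
  have h1 : ∀ j : TPt d N', ‖(fun _ : TPt d N' => (1 : ℂ)) j‖ ≤ Real.exp c.κ₁ := fun _ => by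
    rw [norm_one]; exact Real.one_le_exp hκ₁
  exact ⟨W₀, T₀, dec₀, W, T, SX, A, D, hT, hker, hV1,
    fun u hu y y' => blockNorm_kernel_le hB' (by linarith) (fun _ => 1) h1 u hu y y', hdomT⟩

/-- **THE SAME END WITH THE ENDPOINT DECORATION — NO LETTER BEYOND FILE 50's.**  51's `blockWalkExpansion_tail_decorated_endpoint`
decorates each tail jump by the parameter cells of the `X`-cubes within `R_b` of its start, using ONLY the one-scale END's own packing
letter `hpack` (no tube count, no rate shift); so the decorated-tail END asks exactly 50's hypotheses with the tail nesting
`ρ₀ − 2μ − κ₁P∕r₀ ≤ ρ_V` and the margin `q_t` formed with `K̄_V = e^{κ₁P}·(e^{(ρ_V−ρ₀+ε₀)·2R_b}·λ₁c_μ²)`.  HONEST LIMIT (print vs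
shape): the tree's `BlockWalkExpansion` certifies BOUNDS + σ-localisation (`indep`, `through`); print's power-one decoration has in
addition the EXACT DECOUPLING of [II] p. 4 *«kernels of the operators H(s), G(s), H₀(s) vanish, unless both arguments are in the
interior of one component of Y(σ)»* at `s = 0` off `Y(σ)`, which holds when each term's parameter set contains every cube its
(CONNECTED) localization domain meets — true for 38's decoration of walks and for 51's TUBE decoration along a connected path, NOT for
the endpoint decoration (a jump starting far inside `Y₀` and landing outside survives).  Use `blockWalkExpansion_accretive_tail_decorated`
with connected tubes where exact decoupling is wanted; this variant is the bounds-only economy class.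
[cite: Balaban1985BackgroundPropagators, Thm 3.2 (3.48) p.398, Thm 3.10 (3.107)–(3.108) p.416, (3.130) p.421, p.422, (3.154) p.427; Balaban1988RG2Cluster, p.3, (1.11) p.5, p.13] -/
theorem blockWalkExpansion_accretive_tail_endpoint
    (hanchor : ∀ b, L₀.anchor b ∈ L₀.dom b) (hdiam : ∀ b, ∀ z ∈ L₀.dom b, ∀ z' ∈ L₀.dom b, tdist1 K z z' ≤ r)
    (hJ0 : ∀ b, L₀.J b = ∅) (hmult : ∀ z : UT K, (Finset.univ.filter fun b => L₀.anchor b = z).card ≤ nD)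
    (hsupp : ∀ b y, y ∉ Es b → h b y = 0) (habs : ∀ b y, |h b y| ≤ 1) (hE : ∀ b y, y ∈ Es b → cubn y ∈ L₀.dom b)
    (hKan : ∀ i j, DifferentiableOn ℂ (fun u => K0 u i j) (ball (0 : E) R))
    (hKbd : ∀ u ∈ ball (0 : E) R, ∀ y y', blockNorm cubn cubn (K0 u) y y' ≤ CK) (hCK : 0 ≤ CK)
    (hM : 0 < M) (hr₁ : 0 ≤ r₁) (hsymm : ∀ i j, ds i j = ds j i) (hd0 : ∀ j, ds j j = 0)
    (hLip : ∀ b i j, |h b i - h b j| ≤ ds i j / M) (hKrange : ∀ u i j, K0 u i j ≠ 0 → ds i j ≤ r₁)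
    (hdomE : ∀ b i, (∃ k ∈ Es b, ds i k ≤ r₁) → cubn i ∈ L₀.dom b)
    (hcard : ∀ b, (L₀.dom b).card ≤ nC)
    (hm : 0 < m) (hκc : 0 ≤ κc)
    (hcoer : ∀ u ∈ ball (0 : E) R, ∀ j, ∀ z : n → ℂ, m * nsq z ≤ (conjForm (1 + K0 u) κc (fun e => ds e j) z).re)
    (hκ' : 0 ≤ κ') (hcmp : ∀ i j, ρ₀ * tdist1 K (cubn i) (cubn j) ≤ κ' * ds i j)
    (hcs' : 0 ≤ cs') (hsite' : ∀ i, ∑ j, Real.exp (-((κc - κ') * ds i j)) ≤ cs')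
    (hκ₁₀ : 0 ≤ c₀.κ₁) (hr : 0 ≤ r) (hμ : 0 ≤ μ) (hμε : 3 * μ ≤ ε₀) (hμκ : 4 * μ ≤ κ₀) (hwin : κ₀ + μ ≤ ρ₀ - ε₀)
    (hcμ : 0 ≤ cμ) (hrow : RowSum (toB6 (torusGeom K 0 0 0) 0 True) μ cμ)
    (hq : cμ * (cμ * 1 * (1 * (((nC * (r₁ / M * CK * Real.exp (κ' * r₁)) * (cs' / m)) * Real.exp (c₀.κ₁ * (0 : ℕ))) *
      Real.exp (μ * r) * (nD * cμ))) * cμ) * cμ < 1)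
    (cellOf : UT K → TPt d N') (J' : L₀.B → Finset (TPt d N')) (hJ' : ∀ b, J' b ⊆ (L₀.dom b).image cellOf)
    (hJ'X : ∀ b, (J' b).Nonempty → (L₀.dom b ∩ X).Nonempty) {P : ℕ} {r₀ Rb : ℝ} (hr₀ : 0 < r₀) (hRD : r₀ + r ≤ Rb)
    (hpack : ∀ a : UT K, ∃ S : Finset (TPt d N'), S.card ≤ P ∧ ∀ z, tdist1 K a z ≤ Rb → cellOf z ∈ S)
    (hκ₁ : 0 ≤ c.κ₁) (hshift : c.κ₁ * (P / r₀) ≤ ε₀ - 5 * μ)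
    -- the tail
    (hK1an : ∀ i j, DifferentiableOn ℂ (fun u => K1 u i j) (ball (0 : E) R))
    (hK1bd : ∀ u ∈ ball (0 : E) R, ∀ y y', blockNorm cubn cubn (K1 u) y y' ≤ lam1 * Real.exp (-(ρV * tdist1 K y y')))
    (hlam1 : 0 ≤ lam1) (hρV : ρ₀ - 2 * μ - c.κ₁ * (P / r₀) ≤ ρV)
    (hKW : Real.exp (c.κ₁ * P) * (Real.exp ((ε₀ - 3 * μ) * (2 * r)) *
          (cμ * (((cs' / m) * Real.exp (c₀.κ₁ * (0 : ℕ))) * Real.exp (μ * r) * (nD * cμ)) *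
            (1 * (1 - cμ * (cμ * 1 * (1 * (((nC * (r₁ / M * CK * Real.exp (κ' * r₁)) * (cs' / m)) *
              Real.exp (c₀.κ₁ * (0 : ℕ))) * Real.exp (μ * r) * (nD * cμ))) * cμ) * cμ)⁻¹) * cμ)) ≤ KW)
    (hqt : cμ * (cμ * 1 * (1 * (cμ * (Real.exp (c.κ₁ * P) * (Real.exp ((ρV - (ρ₀ - ε₀)) * (2 * Rb)) * (lam1 * cμ * cμ))) *
      KW * cμ)) * cμ) * cμ < 1) :
    ∃ (W₀ : Type) (T₀ : W₀ → (TPt d N' → ℂ) → E → Matrix n n ℂ) (dec₀ : W₀ → Finset (TPt d N'))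
      (W : Type) (T : W → (TPt d N' → ℂ) → E → Matrix n n ℂ) (SX : Set W) (A : W → ℝ) (D : W → UT K → UT K → ℝ),
      BlockWalkExpansion c cubn cubn
        (fun σ u => decKernel T₀ dec₀ σ u *
          (1 + decKernel (fun (ab : UT K × UT K) (_ : TPt d N' → ℂ) u => blockCut cubn ab.1 ab.2 (K1 u))
              (endpointDec cellOf X Rb) σ u * decKernel T₀ dec₀ σ u)⁻¹) X R
        (ε₀ - 3 * μ - c.κ₁ * (P / r₀) - 2 * μ) (κ₀ - 2 * μ - 2 * μ)
        (cμ * KW * (1 * (1 - cμ * (cμ * 1 * (1 * (cμ *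
          (Real.exp (c.κ₁ * P) * (Real.exp ((ρV - (ρ₀ - ε₀)) * (2 * Rb)) * (lam1 * cμ * cμ))) * KW * cμ)) * cμ) * cμ)⁻¹) * cμ)
        T SX A D (ρ₀ - 3 * μ - c.κ₁ * (P / r₀) - 2 * μ) ∧
      (∀ u ∈ ball (0 : E) R, decKernel T₀ dec₀ (fun _ => 1) u =
        (withOp L₀ fun b u => Hd h b * extend (compress (1 + K0 u) (Es b))⁻¹ * Hd h b).kernel (fun _ => 1) u *
          ((1 : Matrix n n ℂ) + (-1 : ℂ) •
            (withOp L₀ fun b u =>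
              (Hd h b * K0 u - K0 u * Hd h b) * extend (compress (1 + K0 u) (Es b))⁻¹ * Hd h b).kernel (fun _ => 1) u)⁻¹) ∧
      (∀ u ∈ ball (0 : E) R,
        decKernel (fun (ab : UT K × UT K) (_ : TPt d N' → ℂ) u => blockCut cubn ab.1 ab.2 (K1 u)) (endpointDec cellOf X Rb)
          (fun _ => 1) u = K1 u) ∧
      (∀ u ∈ ball (0 : E) R, ∀ y y', blockNorm cubn cubn (decKernel T₀ dec₀ (fun _ => 1) u) y y' ≤
        KW * Real.exp (-((κ₀ - 2 * μ) * tdist1 K y y'))) ∧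
      ∀ ω, DomBy (toB6 (torusGeom K 0 0 0) 0 True) (D ω) := by
  obtain ⟨W₀, T₀, A₀, D₀, dec₀, hB, hker, hdom₀⟩ := accretive_print_rate hanchor hdiam hJ0 hmult hsupp habs hE hKan hKbd hCK hM
    hr₁ hsymm hd0 hLip hKrange hdomE hcard hm hκc hcoer hκ' hcmp hcs' hsite' hκ₁₀ hr hμ hμε (by linarith) hwin hcμ hrow hq cellOf
    J' hJ' hJ'X hr₀ hRD hpack hκ₁ (by linarith)
  have hq1 : 0 < 1 - cμ * (cμ * 1 * (1 * (((nC * (r₁ / M * CK * Real.exp (κ' * r₁)) * (cs' / m)) *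
      Real.exp (c₀.κ₁ * (0 : ℕ))) * Real.exp (μ * r) * (nD * cμ))) * cμ) * cμ := by linarith
  have hK0 : 0 ≤ Real.exp (c.κ₁ * P) * (Real.exp ((ε₀ - 3 * μ) * (2 * r)) *
      (cμ * (((cs' / m) * Real.exp (c₀.κ₁ * (0 : ℕ))) * Real.exp (μ * r) * (nD * cμ)) *
        (1 * (1 - cμ * (cμ * 1 * (1 * (((nC * (r₁ / M * CK * Real.exp (κ' * r₁)) * (cs' / m)) *
          Real.exp (c₀.κ₁ * (0 : ℕ))) * Real.exp (μ * r) * (nD * cμ))) * cμ) * cμ)⁻¹) * cμ)) := by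
    have := hm.le; positivity
  have hB' := blockWalkExpansion_mono_const hB hKW
  have hsh : 0 ≤ c.κ₁ * (P / r₀) := mul_nonneg hκ₁ (div_nonneg (Nat.cast_nonneg P) hr₀.le)
  have hRb : 0 ≤ Rb := by linarith
  -- the endpoint-decorated tail at window ρ_V − (ρ₀ − ε₀) and torus rate κ₀ − μ
  obtain ⟨hV, hV1, hVdom⟩ := blockWalkExpansion_tail_decorated_endpoint (c₀ := c₀) (c := c) (cubn := cubn) (X := X)
    (ε := ρV - (ρ₀ - ε₀)) (κ := κ₀ - μ) hκ₁₀ hlam1 hμ (by linarith) (by linarith) hrow hK1an hK1bd cellOf hRb hpack hκ₁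
    (by linarith)
  obtain ⟨W, T, SX, A, D, hT, hdomT⟩ := blockWalkExpansion_tail_bwe hB' hdom₀ hV hVdom hμ (by linarith) (by linarith) (by linarith)
    (by linarith) (by linarith) (by linarith) (by positivity) (hK0.trans hKW) hcμ hrow hqt
  have h1 : ∀ j : TPt d N', ‖(fun _ : TPt d N' => (1 : ℂ)) j‖ ≤ Real.exp c.κ₁ := fun _ => by
    rw [norm_one]; exact Real.one_le_exp hκ₁
  exact ⟨W₀, T₀, dec₀, W, T, SX, A, D, hT, hker, hV1,
    fun u hu y y' => blockNorm_kernel_le hB' (by linarith) (fun _ => 1) h1 u hu y y', hdomT⟩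

/-- **… AND AT `s ≡ 1` THE KERNEL IS `(1 + K′₀(u) + K′₁(u))⁻¹`**: the decorated tail's `s ≡ 1` kernel is `K′₁(u)` (51), so 50's
`accretive_tail_one_eq_inv` applies verbatim — every invertibility letter discharged (48, conjugated coercivity, Gershgorin).
[cite: Balaban1985BackgroundPropagators, (3.88)–(3.90) p.409, (3.96) p.411, (3.130) p.421–422; Balaban1988RG2Cluster, p.3] -/
theorem accretive_tail_decorated_one_eq_inv (c₀ : B13.Consts) {W₀ : Type} {T₀ : W₀ → (TPt d N' → ℂ) → E → Matrix n n ℂ}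
    {dec₀ : W₀ → Finset (TPt d N')} {κW : ℝ} {Vs : (TPt d N' → ℂ) → E → Matrix n n ℂ}
    (hV1 : ∀ u ∈ ball (0 : E) R, Vs (fun _ => 1) u = K1 u)
    (hker : ∀ u ∈ ball (0 : E) R, decKernel T₀ dec₀ (fun _ => 1) u =
      (withOp L₀ fun b u => Hd h b * extend (compress (1 + K0 u) (Es b))⁻¹ * Hd h b).kernel (fun _ => 1) u *
        ((1 : Matrix n n ℂ) + (-1 : ℂ) •
          (withOp L₀ fun b u =>
            (Hd h b * K0 u - K0 u * Hd h b) * extend (compress (1 + K0 u) (Es b))⁻¹ * Hd h b).kernel (fun _ => 1) u)⁻¹)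
    (hWbd : ∀ u ∈ ball (0 : E) R, ∀ y y',
      blockNorm cubn cubn (decKernel T₀ dec₀ (fun _ => 1) u) y y' ≤ KW * Real.exp (-(κW * tdist1 K y y')))
    (hKW : 0 ≤ KW)
    (hanchor : ∀ b, L₀.anchor b ∈ L₀.dom b) (hdiam : ∀ b, ∀ z ∈ L₀.dom b, ∀ z' ∈ L₀.dom b, tdist1 K z z' ≤ r)
    (hJ0 : ∀ b, L₀.J b = ∅) (hmult : ∀ z : UT K, (Finset.univ.filter fun b => L₀.anchor b = z).card ≤ nD)
    (hsum : ∀ y, ∑ b, h b y ^ 2 = 1) (hsupp : ∀ b y, y ∉ Es b → h b y = 0) (habs : ∀ b y, |h b y| ≤ 1)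
    (hE : ∀ b y, y ∈ Es b → cubn y ∈ L₀.dom b)
    (hKan : ∀ i j, DifferentiableOn ℂ (fun u => K0 u i j) (ball (0 : E) R))
    (hKbd : ∀ u ∈ ball (0 : E) R, ∀ y y', blockNorm cubn cubn (K0 u) y y' ≤ CK) (hCK : 0 ≤ CK)
    (hM : 0 < M) (hr₁ : 0 ≤ r₁) (hsymm : ∀ i j, ds i j = ds j i) (hd0 : ∀ j, ds j j = 0)
    (hLip : ∀ b i j, |h b i - h b j| ≤ ds i j / M) (hKrange : ∀ u i j, K0 u i j ≠ 0 → ds i j ≤ r₁)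
    (hdomE : ∀ b i, (∃ k ∈ Es b, ds i k ≤ r₁) → cubn i ∈ L₀.dom b)
    (hcard : ∀ b, (L₀.dom b).card ≤ nC) (hcov : ∀ y : UT K, (Finset.univ.filter fun b => y ∈ L₀.dom b).card ≤ nB)
    (hm : 0 < m) (hκc : 0 ≤ κc)
    (hcoer : ∀ u ∈ ball (0 : E) R, ∀ j, ∀ z : n → ℂ, m * nsq z ≤ (conjForm (1 + K0 u) κc (fun e => ds e j) z).re)
    (hκ' : 0 ≤ κ') (hρ₀ : 0 ≤ ρ₀) (hcmp : ∀ i j, ρ₀ * tdist1 K (cubn i) (cubn j) ≤ κ' * ds i j)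
    (hcs' : 0 ≤ cs') (hsite' : ∀ i, ∑ j, Real.exp (-((κc - κ') * ds i j)) ≤ cs')
    (hsmall : (nB : ℝ) * nC * (nC * (r₁ / M * CK * Real.exp (κ' * r₁)) * (cs' / m)) < 1)
    (hK1bd : ∀ u ∈ ball (0 : E) R, ∀ y y', blockNorm cubn cubn (K1 u) y y' ≤ lam1 * Real.exp (-(ρV * tdist1 K y y')))
    (hlam1 : 0 ≤ lam1) (hrow : RowSum (toB6 (torusGeom K 0 0 0) 0 True) μ cμ) (hμρ : μ ≤ ρV) (hμκ : μ ≤ κW)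
    (hsmallt : lam1 * cμ * (KW * cμ) < 1) :
    ∀ u ∈ ball (0 : E) R, decKernel T₀ dec₀ (fun _ => 1) u * (1 + Vs (fun _ => 1) u * decKernel T₀ dec₀ (fun _ => 1) u)⁻¹ =
      (1 + K0 u + K1 u)⁻¹ := by
  intro u hu
  rw [hV1 u hu]
  exact accretive_tail_one_eq_inv c₀ hker hWbd hKW hanchor hdiam hJ0 hmult hsum hsupp habs hE hKan hKbd hCK hM hr₁ hsymm hd0 hLip
    hKrange hdomE hcard hcov hm hκc hcoer hκ' hρ₀ hcmp hcs' hsite' hsmall hK1bd hlam1 hrow hμρ hμκ hsmallt u hu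

end Summit.QuantumFields.BalabanUV.Gaps.D4WalkBlockAccretiveTailDecorated

end
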